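import Literature.MathematicalPhysics.QuantumFieldTheory.Balaban1983to89.B14Eq227LocalizedTerms
import Literature.MathematicalPhysics.QuantumFieldTheory.Balaban1983to89.B14Def2ImprovedSpace

/-!
# `Balaban1983to89.B14TkImagesAnalyticity` — CMP 119 §2 p. 262: the ANALYTICITY HALF of the improved inductive assumptions
# for the images of the operation 𝐓 (*«after the operation T we obtain expressions with better analyticity and decay
# properties … the newly created expressions E^{(k)}, R^{(k)}, B^{(k)} are defined on slightly larger spaces»*), WITH BODY
# as holomorphy of the newest terms on the ENLARGED spaces of `B14.Def2ImprovedSpace`, plus the one-step bookkeeping of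
# the (2.27)(ii) / (2.30) / (2.41)(ii) clause (`LFHypAnalytic k ∧` new-index clause ` ↔ LFHypAnalytic (k+1)`)

statement-level skeleton of published theorems with citation tags; proofs where landed; nothing here is a claim
about the Yang–Mills mass gap.

CITATION HEADER (lean-in-tree rule).  Source: T. Bałaban, *Convergent renormalization expansions for lattice gauge
theories*, Commun. Math. Phys. **119**, 243–285 (1988), doi:10.1007/bf01217741 [Balaban1988Convergent] (cell paper
B14 = «[III]»; held `paper:balaban1988-cmp119-convergent-renormalization`, journal page = PDF page + 242; p. 262 read on
the text layer `p0020`, pp. 259–261 on `p0017`–`p0019`); the printed instance of the enlargement is [I] = T. Bałaban,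
*Renormalization group approach to lattice gauge field theories. I*, Commun. Math. Phys. **109** (1987) 249–301
[Balaban1987RG1] (held `paper:balaban1987-cmp109-rg-i-small-field`, journal page = PDF page + 248), (3.28)/(3.34) p. 277
and Lemma 4 p. 280.  Cross-ladder literature typing R141 (D) (director-ym LINE №21, row P7 `contT` of the Track A K0′
component table; coordinator ym-lit-coord-1 answer 17:20:50Z «LOCATED + fallback file `B14TkImagesAnalyticity.lean`»),
seat ym-lit-type-6; companion of the B14 fold owner's (lit-balaban-r11) `B14.Eq227LocalizedTerms.LFHypAnalytic` (gen 99)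
and `B14.Def2ImprovedSpace.LFHypImprovedSpace` (gen 98), whose docstrings record the residual typed here: *«Larger
analyticity spaces are not typed (D-f2.7)»* (`Step.LFHypImproved`), *«NOT ASSERTED … analyticity in content (the spaces
are abstract `Set Φ`, DIVERGENCE D-f2.1/D-f2.7)»* (`B14Def2ImprovedSpace`), *«NOT TYPED (located, successors): … the
«slightly larger spaces» of the new terms (r11 DIVERGENCE D-f2.7)»* (`Node00.Sect2FormOfRecord`).

THE PRINTED TEXT (verbatim).  [III] p. 262: *«All the inductive assumptions are formulated for the effective density
obtained after the k-th operation 𝐑T. It is a composition of the operations T and 𝐑, applied in this order, and after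
the operation T we obtain expressions with better analyticity and decay properties. More precisely, the expressions
with indices j < k are exactly as described above, but the newly created expressions E^{(k)}, R^{(k)}, B^{(k)} are
defined on slightly larger spaces, with the coefficients in their definition bigger by β multiplied by a corresponding
number, and they have better decay properties, with the number κ replaced, for example, by (1+4β)κ. Such improved bounds
are needed for the R-operation.»*  The «coefficients in their definition» are the radii `α_{0,j}, α_{1,j}` (2.28) p. 259
of the analyticity spaces `U^c_j(X, α_{0,j}, α_{1,j})` of (2.27)(ii) (*«there exists an analytic function
𝐄^{(j)}(X, (𝐔,𝐉), z) of the variables (𝐔,𝐉) ∈ U^c_j(X, α_{0,j}, α_{1,j}), which is an extension of this term»*), of (2.30)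
p. 260 (*«Terms of this representation have the properties (i)–(iii) formulated above»*) and `α̃₀, α̃₁` of
`Ũ^c_j(X, α̃₀, α̃₁)` ((2.34)–(2.39), (2.41)(ii) p. 261 *«it has an extension to an analytic function on the space
Ũ^c_j(X, α̃₀, α̃₁)»*).  [I] p. 277: *«We consider functions in (3.28), or (3.34), on the space
U^c_{k+1}(□₀, (1+2β)α₀, (1+2β)α₁, α₀) of configurations 𝐔, 𝐉»*; [I] Lemma 4 p. 280: *«For 𝐔 ∈ U′ᶜ_{k+1}(□₀, (1+2β)α₀,
(1+2β)α₁) … (3.53) … The functions in (3.53) are analytic on the above spaces.»*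

WHAT THIS FILE TYPES AND PROVES (0 `sorry`; three `Prop`-structures and one `abbrev`, all WITH BODY — HYPOTHESIS
PREDICATES on the abstract tower `Step.LFTower`, of the species of `LFHypAnalytic` / `LFHypImprovedSpace`; NO named fact:
Theorem 1 p. 262 (row B14.Thm1, `B14.Thm1Printed`) is what asserts the inductive assumptions of Bałaban's terms).
* §1 **the new-index clause** `LFAnalyticAt T c k` — (2.27)(ii) / (2.30) / (2.41)(ii) AT THE NEW INDEX `k+1` on the
  ordinary spaces (radii (2.28) at `g_{k+1}`; `Ũ^c_{k+1} = T.spaceB (k+1)`): the analyticity OBLIGATION of the step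
  `k → k+1`, in the shape of `B12.Eq118Analyticity263.SFAnalyticAt` ([I]) and of `Step.LFNewTerms` (bounds).  Bookkeeping
  PROVED into the fold owner's cumulative predicate: `LFHypAnalytic.succ` / `.newTerm` / `.succ_iff`
  (`LFHypAnalytic T c (k+1) ↔ LFHypAnalytic T c k ∧ LFAnalyticAt T c k` — *«the expressions with indices j < k are
  exactly as described above»*), the form in which a per-step producer feeds `Node00.Sect2.LawsT`'s conjunct
  `LFHypAnalytic T c (k+1)`.
* §2 **p. 262's analyticity half WITH BODY** `LFHypAnalyticImprovedSpace T c β n₀ n₁ k SB` — at the newest index `k`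
  (guards `1 ≤ k`, letters and shape of `LFHypImprovedSpace`): `T.E k X z g` (`g ∈ [0, γ]`) and `T.R k X` HOLOMORPHIC
  (`AnalyticOnNhd ℂ`) on the ENLARGED space `U^c_k(X, (1+n₀β)α_{0,k}, (1+n₁β)α_{1,k})`
  = `T.space k X (enl n₀ β (α₀ g_k)) (enl n₁ β (α₁ g_k))` (`B14.Def2ImprovedSpace.enl`), and `φ ↦ T.B k X φ a` holomorphic
  on the enlarged boundary-term space `SB X ⊇ Ũ^c_k` (datum, as in `LFHypImprovedSpace`); `instI` = the [I] numbers
  `n₀ = n₁ = 2`.  CARRIER READING as in `LFHypAnalytic`: `Φ` complex normed (print's (𝐔,𝐉) = `G^c × 𝔤^c`-valued bond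
  functions, [I] p. 262), print's spaces open, «analytic on» = `AnalyticOnNhd ℂ`.
* §3 PROVED bookkeeping: restriction along the inclusions «old space ⊆ slightly larger space» gives the new-index clause on
  the ORDINARY spaces (`toAnalyticAt`, and `toAnalyticAt_of_improvedSpace` taking the inclusions from an
  `LFHypImprovedSpace` witness — the decay half and the analyticity half live on the same enlarged sets), hence with
  `LFHypAnalytic.succ` the cumulative clause at `k+1` (`lfHypAnalytic_succ`); `zero` (vacuous at `k = 0`);
  `iff_analyticAt_of_zero` (zero enlargement, `SB = Ũ^c`: the predicate IS the new-index clause — conservative extension);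
  `anti` (a larger enlargement is a stronger hypothesis, given monotone abstract spaces); continuity / complex
  differentiability on the enlarged spaces; and the CHART form print consumes — composed with a holomorphic chart into the
  ENLARGED space the chart functional is holomorphic (`analyticOnNhd_E_chart` / `_R_chart` / `_B_chart`), the hypothesis
  shape of the Cauchy-estimate files (`B14Claim283RAnalytic`, `B14.Eq350KernelCauchy`: Cauchy estimates on the larger space
  are how print turns «better analyticity» into the improved bounds *«needed for the R-operation»*).
* §4 **the whole p. 262 sentence as ONE predicate** `TImageImproved T c β n₀ n₁ k SB := LFHypImprovedSpace … ∧
  LFHypAnalyticImprovedSpace …` («better analyticity AND decay properties on slightly larger spaces»), with `zero`, the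
  projections, `toImproved` (⊢ `Step.LFHypImproved`, the currency of `Step.LFNewTerms.improved`) and `toAnalyticAt`.

HONEST SCOPE.  (1) DEFINITIONS of hypothesis predicates + kernel-checked bookkeeping (`AnalyticOnNhd.mono/comp`); nothing
of Bałaban's 𝐄, 𝐑, 𝐁 is asserted — that the 𝐓-image of `ρ_k` satisfies them is the Theorem of p. 245 / Theorem 1 p. 262
(rows B14.ThmP245, B14.Thm1; hypotheses `ThmP245Printed`, `Thm1Printed` of `B14.lean`), proved in print in §3 (pp. 277–283)
and not here.  (2) [III] prints no «corresponding number»: `n₀, n₁` are parameters ([I]'s `2` recorded as `instI` only), the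
enlargement of `Ũ^c_k` is the datum `SB` (the abstract tower carries `Ũ^c_k` without radii).  (3) The one-carrier
instantiation of `Φ` (B14-CLOSURE §3 item 3) is not attempted.  (4) This is NOT a discharge of any record-level proviso
(e.g. a continuity-of-transport clause at the Node00 record): those are knits at the record, prover work.

## References
* [Balaban1988Convergent] T. Bałaban, Commun. Math. Phys. 119 (1988) 243–285: §2 p. 262; (2.27)–(2.28) p. 259, (2.30)
  p. 260, (2.34)–(2.42) p. 261; Theorem p. 245; §3 pp. 277–283.
* [Balaban1987RG1] T. Bałaban, Commun. Math. Phys. 109 (1987) 249–301: (1.9)–(1.18) pp. 261–263, (3.28)/(3.34) p. 277,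
  Lemma 4 p. 280.
-/

noncomputable section

open Set

namespace Literature.MathematicalPhysics.QuantumFieldTheory.Balaban1983to89.B14.TkImagesAnalyticity

open Literature.MathematicalPhysics.QuantumFieldTheory.Balaban1983to89
open Step B14.Def2ImprovedSpace B14.Eq227LocalizedTerms

variable {P : Params} {G : Type*} [GaugeGroup G] {Φ 𝒢 𝔄 : Type*}

/-! ## §1  The analyticity clause AT THE NEW INDEX `k+1` (ordinary spaces) and its one-step bookkeeping -/

/-- **(2.27)(ii) / (2.30) / (2.41)(ii) AT THE NEW INDEX `k+1`** — the analyticity obligation of the step `k → k+1` on the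
ORDINARY spaces (radii (2.28) at `g_{k+1}`, `Ũ^c_{k+1} = T.spaceB (k+1)`): the newly created `𝐄^{(k+1)}(X, ·, z)` (every
coupling `g ∈ [0, γ]`) and `𝐑^{(k+1)}(X, ·)` are holomorphic on `U^c_{k+1}(X, α_{0,k+1}, α_{1,k+1})`, and `𝐁^{(k+1)}(X, ·, a)` on
`Ũ^c_{k+1}(X, α̃₀, α̃₁)` — p. 279 *«we obtain Tρ_k represented exactly in the form described by the inductive assumption with
k+1 instead of k»*.  Shape of `B12.Eq118Analyticity263.SFAnalyticAt` ([I]) and of `Step.LFNewTerms`. [cite: Balaban1988Convergent, (2.27)(ii) p.259, (2.30) p.260, (2.41)(ii) p.261, §3 p.279] -/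
structure LFAnalyticAt [NormedAddCommGroup Φ] [NormedSpace ℂ Φ] (T : LFTower P G Φ 𝒢 𝔄) (c : LFConsts) (k : ℕ) :
    Prop where
  analyticE : ∀ (X : (T.sys (k + 1)).Dom) (z : T.Pt (k + 1)) (g : ℝ), 0 ≤ g → g ≤ c.γ →
    AnalyticOnNhd ℂ (T.E (k + 1) X z g)
      (T.space (k + 1) X (c.alpha0 (T.flow.g (k + 1))) (c.alpha1 (T.flow.g (k + 1))))
  analyticR : ∀ (X : (T.sys (k + 1)).Dom),
    AnalyticOnNhd ℂ (T.R (k + 1) X) (T.space (k + 1) X (c.alpha0 (T.flow.g (k + 1))) (c.alpha1 (T.flow.g (k + 1))))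
  analyticB : ∀ (X : (T.sys (k + 1)).Dom) (a : 𝔄), AnalyticOnNhd ℂ (fun φ => T.B (k + 1) X φ a) (T.spaceB (k + 1) X)

section StepBookkeeping

variable [NormedAddCommGroup Φ] [NormedSpace ℂ Φ] {T : LFTower P G Φ 𝒢 𝔄} {c : LFConsts} {k : ℕ}

/-- ONE STEP of bookkeeping for the fold owner's cumulative clause: (ii) at the scales `≤ k` and at the new index `k+1` give
(ii) at the scales `≤ k+1` (*«the expressions with indices j < k are exactly as described above»*, p. 262).
[cite: Balaban1988Convergent, §2 p.262] -/
theorem _root_.Literature.MathematicalPhysics.QuantumFieldTheory.Balaban1983to89.B14.Eq227LocalizedTerms.LFHypAnalytic.succ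
    (h : LFHypAnalytic T c k) (hn : LFAnalyticAt T c k) : LFHypAnalytic T c (k + 1) where
  analyticE := fun j h1 hj => by
    rcases Nat.of_le_succ hj with hj' | rfl
    · exact h.analyticE j h1 hj'
    · exact hn.analyticE
  analyticR := fun j h1 hj => by
    rcases Nat.of_le_succ hj with hj' | rfl
    · exact h.analyticR j h1 hj'
    · exact hn.analyticR
  analyticB := fun j h1 hj => by
    rcases Nat.of_le_succ hj with hj' | rfl
    · exact h.analyticB j h1 hj'
    · exact hn.analyticB

/-- Conversely, (ii) at the scales `≤ k+1` contains the clause at the new index. [cite: Balaban1988Convergent, (2.27)(ii) p.259, §2 p.262] -/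
theorem _root_.Literature.MathematicalPhysics.QuantumFieldTheory.Balaban1983to89.B14.Eq227LocalizedTerms.LFHypAnalytic.newTerm
    (h : LFHypAnalytic T c (k + 1)) : LFAnalyticAt T c k where
  analyticE := h.analyticE (k + 1) k.succ_pos le_rfl
  analyticR := h.analyticR (k + 1) k.succ_pos le_rfl
  analyticB := h.analyticB (k + 1) k.succ_pos le_rfl

/-- `LFHypAnalytic T c (k+1) ↔ LFHypAnalytic T c k ∧ LFAnalyticAt T c k`. [cite: Balaban1988Convergent, §2 p.262] -/
theorem _root_.Literature.MathematicalPhysics.QuantumFieldTheory.Balaban1983to89.B14.Eq227LocalizedTerms.LFHypAnalytic.succ_iff :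
    LFHypAnalytic T c (k + 1) ↔ LFHypAnalytic T c k ∧ LFAnalyticAt T c k :=
  ⟨fun h => ⟨h.mono (Nat.le_succ k), h.newTerm⟩, fun h => h.1.succ h.2⟩

/-- The new-index clause gives continuity of the new `𝐄`-terms on their space. [cite: Balaban1988Convergent, (2.27)(ii) p.259] -/
theorem LFAnalyticAt.continuousOn_E (h : LFAnalyticAt T c k) (X : (T.sys (k + 1)).Dom) (z : T.Pt (k + 1)) {g : ℝ}
    (hg0 : 0 ≤ g) (hgγ : g ≤ c.γ) :
    ContinuousOn (T.E (k + 1) X z g)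
      (T.space (k + 1) X (c.alpha0 (T.flow.g (k + 1))) (c.alpha1 (T.flow.g (k + 1)))) :=
  (h.analyticE X z g hg0 hgγ).continuousOn

/-- … and of the new `𝐑`-terms ((2.30)). [cite: Balaban1988Convergent, (2.30) p.260] -/
theorem LFAnalyticAt.continuousOn_R (h : LFAnalyticAt T c k) (X : (T.sys (k + 1)).Dom) :
    ContinuousOn (T.R (k + 1) X)
      (T.space (k + 1) X (c.alpha0 (T.flow.g (k + 1))) (c.alpha1 (T.flow.g (k + 1)))) :=
  (h.analyticR X).continuousOn

end StepBookkeeping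

/-! ## §2  p. 262: the analyticity half of the improved assumptions, ON THE SLIGHTLY LARGER SPACES, WITH BODY -/

/-- **B14 p. 262, the ANALYTICITY half of the improved inductive assumptions for the NEWLY CREATED terms `E^{(k)}, R^{(k)},
B^{(k)}` WITH THE SPACE CLAUSE** (*«after the operation T we obtain expressions with better analyticity … properties … the
newly created expressions E^{(k)}, R^{(k)}, B^{(k)} are defined on slightly larger spaces, with the coefficients in their
definition bigger by β multiplied by a corresponding number»*): on the tower `T` with constants `c`, at the newest index
`k`, with `β = βc`, «corresponding numbers» `n₀, n₁` for the two radii of `U^c_k(X, α_{0,k}, α_{1,k})` and an enlarged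
boundary-term space `SB X ⊇ Ũ^c_k(X, α̃₀, α̃₁)` (the letters of `LFHypImprovedSpace`, which types the DECAY half on the same
sets):
* `analyticE` — (2.27)(ii) for `𝐄^{(k)}(X, ·, z)`, every coupling `g ∈ [0, γ]`, as holomorphy on
  `U^c_k(X, (1+n₀β)α_{0,k}, (1+n₁β)α_{1,k})`;
* `analyticR` — (2.30)(ii) for `𝐑^{(k)}(X, ·)` on the same enlarged space;
* `analyticB` — (2.41)(ii) for `𝐁^{(k)}(X, ·, a)` on `SB X`.
Printed instance of the enlargement: [I] Lemma 4 p. 280 (*«The functions in (3.53) are analytic on the above spaces»*,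
`U′ᶜ_{k+1}(□₀, (1+2β)α₀, (1+2β)α₁)`).  `Φ` complex normed; «analytic on» = `AnalyticOnNhd ℂ` (print's spaces are open).
[cite: Balaban1988Convergent, §2 p.262; Balaban1987RG1, Lemma 4 p.280] -/
structure LFHypAnalyticImprovedSpace [NormedAddCommGroup Φ] [NormedSpace ℂ Φ] (T : LFTower P G Φ 𝒢 𝔄) (c : LFConsts)
    (βc n₀ n₁ : ℝ) (k : ℕ) (SB : (T.sys k).Dom → Set Φ) : Prop where
  analyticE : 1 ≤ k → ∀ (X : (T.sys k).Dom) (z : T.Pt k) (g : ℝ), 0 ≤ g → g ≤ c.γ →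
    AnalyticOnNhd ℂ (T.E k X z g)
      (T.space k X (enl n₀ βc (c.alpha0 (T.flow.g k))) (enl n₁ βc (c.alpha1 (T.flow.g k))))
  analyticR : 1 ≤ k → ∀ (X : (T.sys k).Dom),
    AnalyticOnNhd ℂ (T.R k X) (T.space k X (enl n₀ βc (c.alpha0 (T.flow.g k))) (enl n₁ βc (c.alpha1 (T.flow.g k))))
  analyticB : 1 ≤ k → ∀ (X : (T.sys k).Dom) (a : 𝔄), AnalyticOnNhd ℂ (fun φ => T.B k X φ a) (SB X)

/-- The [I] numbers: radii multiplied by `1 + 2β` (*«U′ᶜ_{k+1}(□₀, (1+2β)α₀, (1+2β)α₁) … The functions in (3.53) are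
analytic on the above spaces»*, [I] Lemma 4 p. 280; (3.28)/(3.34) p. 277), as `B14.Def2ImprovedSpace.instI` for the decay
half. [cite: Balaban1987RG1, Lemma 4 p.280] -/
abbrev instI [NormedAddCommGroup Φ] [NormedSpace ℂ Φ] (T : LFTower P G Φ 𝒢 𝔄) (c : LFConsts) (βc : ℝ) (k : ℕ)
    (SB : (T.sys k).Dom → Set Φ) : Prop :=
  LFHypAnalyticImprovedSpace T c βc 2 2 k SB

/-! ## §3  Bookkeeping PROVED -/

namespace LFHypAnalyticImprovedSpace

variable [NormedAddCommGroup Φ] [NormedSpace ℂ Φ] {T : LFTower P G Φ 𝒢 𝔄} {c : LFConsts} {βc n₀ n₁ : ℝ} {k : ℕ}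

/-- **Restriction along the inclusions**: holomorphy on the slightly larger spaces of the terms created at index `k+1` gives
the new-index clause on the ORDINARY spaces, given the inclusions «old space ⊆ slightly larger space» (`hsub`, `hsubB` —
the content of *«larger»* on an abstract tower, cf. `LFHypImprovedSpace.space_subset/spaceB_subset`).
[cite: Balaban1988Convergent, §2 p.262] -/
theorem toAnalyticAt {SB : (T.sys (k + 1)).Dom → Set Φ} (h : LFHypAnalyticImprovedSpace T c βc n₀ n₁ (k + 1) SB)
    (hsub : ∀ X, T.space (k + 1) X (c.alpha0 (T.flow.g (k + 1))) (c.alpha1 (T.flow.g (k + 1))) ⊆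
      T.space (k + 1) X (enl n₀ βc (c.alpha0 (T.flow.g (k + 1)))) (enl n₁ βc (c.alpha1 (T.flow.g (k + 1)))))
    (hsubB : ∀ X, T.spaceB (k + 1) X ⊆ SB X) : LFAnalyticAt T c k where
  analyticE := fun X z g hg0 hgγ => (h.analyticE k.succ_pos X z g hg0 hgγ).mono (hsub X)
  analyticR := fun X => (h.analyticR k.succ_pos X).mono (hsub X)
  analyticB := fun X a => (h.analyticB k.succ_pos X a).mono (hsubB X)

/-- The same with the inclusions taken from a witness of the DECAY half on the same enlarged sets (`LFHypImprovedSpace`'s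
fields `space_subset`, `spaceB_subset`): p. 262's two halves restrict together. [cite: Balaban1988Convergent, §2 p.262] -/
theorem toAnalyticAt_of_improvedSpace {SB : (T.sys (k + 1)).Dom → Set Φ}
    (h : LFHypAnalyticImprovedSpace T c βc n₀ n₁ (k + 1) SB) (hS : LFHypImprovedSpace T c βc n₀ n₁ (k + 1) SB) :
    LFAnalyticAt T c k :=
  h.toAnalyticAt (hS.space_subset k.succ_pos) (hS.spaceB_subset k.succ_pos)

/-- **The cumulative clause at `k+1`** from (ii) at the scales `≤ k`, the improved analyticity of the terms created at
`k+1`, and the inclusions — *«the expressions with indices j < k are exactly as described above, but the newly created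
expressions … are defined on slightly larger spaces»*: when the index becomes old, holomorphy on the larger space is
remembered only on the ordinary one. [cite: Balaban1988Convergent, §2 p.262] -/
theorem lfHypAnalytic_succ {SB : (T.sys (k + 1)).Dom → Set Φ} (hA : LFHypAnalytic T c k)
    (h : LFHypAnalyticImprovedSpace T c βc n₀ n₁ (k + 1) SB)
    (hsub : ∀ X, T.space (k + 1) X (c.alpha0 (T.flow.g (k + 1))) (c.alpha1 (T.flow.g (k + 1))) ⊆
      T.space (k + 1) X (enl n₀ βc (c.alpha0 (T.flow.g (k + 1)))) (enl n₁ βc (c.alpha1 (T.flow.g (k + 1)))))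
    (hsubB : ∀ X, T.spaceB (k + 1) X ⊆ SB X) : LFHypAnalytic T c (k + 1) :=
  hA.succ (h.toAnalyticAt hsub hsubB)

/-- At `k = 0` the predicate is vacuous (no terms yet: `ρ₀ = exp[−(1/g₀²)A − E]`, Theorem 1's start), as
`LFHypImprovedSpace.zero`. [cite: Balaban1988Convergent, Thm 1 p.262] -/
protected theorem zero (T : LFTower P G Φ 𝒢 𝔄) (c : LFConsts) (βc n₀ n₁ : ℝ) (SB : (T.sys 0).Dom → Set Φ) :
    LFHypAnalyticImprovedSpace T c βc n₀ n₁ 0 SB where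
  analyticE h := absurd h (by omega)
  analyticR h := absurd h (by omega)
  analyticB h := absurd h (by omega)

/-- ZERO ENLARGEMENT (`n₀ = n₁ = 0`, `SB = Ũ^c_{k+1}`): the predicate at the newest index `k+1` IS the new-index clause on the
ordinary spaces — a conservative extension of §1. [cite: Balaban1988Convergent, §2 p.262] -/
theorem iff_analyticAt_of_zero (T : LFTower P G Φ 𝒢 𝔄) (c : LFConsts) (βc : ℝ) (k : ℕ) :
    LFHypAnalyticImprovedSpace T c βc 0 0 (k + 1) (T.spaceB (k + 1)) ↔ LFAnalyticAt T c k := by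
  constructor
  · intro h
    exact h.toAnalyticAt (fun X => by simp) (fun X => le_rfl)
  · intro h
    refine ⟨?_, ?_, fun _ X a => h.analyticB X a⟩
    · intro _ X z g hg0 hgγ
      simpa only [enl_zero_left] using h.analyticE X z g hg0 hgγ
    · intro _ X
      simpa only [enl_zero_left] using h.analyticR X

/-- A LARGER enlargement is a STRONGER hypothesis: with abstract spaces monotone in their radii (`hmono` — true for the
printed spaces, cut out by strict inequalities on derivatives, [I] (1.11)–(1.14), (2.34)–(2.39)), `β ≥ 0`, radii
`α_{0,k}, α_{1,k} ≥ 0`, `n₀ ≤ n₀'`, `n₁ ≤ n₁'` and `SB ⊆ SB'` pointwise, holomorphy on the `(n₀', n₁', SB')`-spaces restricts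
to the `(n₀, n₁, SB)`-spaces. [cite: Balaban1988Convergent, §2 p.262] -/
theorem anti {SB SB' : (T.sys k).Dom → Set Φ} {n₀' n₁' : ℝ} (h : LFHypAnalyticImprovedSpace T c βc n₀' n₁' k SB')
    (hmono : ∀ (X : (T.sys k).Dom) (a b a' b' : ℝ), a ≤ a' → b ≤ b' → T.space k X a b ⊆ T.space k X a' b')
    (hβ : 0 ≤ βc) (hα0 : 0 ≤ c.alpha0 (T.flow.g k)) (hα1 : 0 ≤ c.alpha1 (T.flow.g k))
    (h0 : n₀ ≤ n₀') (h1 : n₁ ≤ n₁') (hSB : ∀ X, SB X ⊆ SB' X) :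
    LFHypAnalyticImprovedSpace T c βc n₀ n₁ k SB where
  analyticE hk X z g hg0 hgγ :=
    (h.analyticE hk X z g hg0 hgγ).mono (hmono X _ _ _ _ (enl_mono h0 hβ hα0) (enl_mono h1 hβ hα1))
  analyticR hk X := (h.analyticR hk X).mono (hmono X _ _ _ _ (enl_mono h0 hβ hα0) (enl_mono h1 hβ hα1))
  analyticB hk X a := (h.analyticB hk X a).mono (hSB X)

variable {SB : (T.sys k).Dom → Set Φ}

/-- Holomorphy on the slightly larger space gives continuity of the newest `𝐄`-terms there. [cite: Balaban1988Convergent, §2 p.262, (2.27)(ii) p.259] -/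
theorem continuousOn_E (h : LFHypAnalyticImprovedSpace T c βc n₀ n₁ k SB) (hk : 1 ≤ k) (X : (T.sys k).Dom) (z : T.Pt k)
    {g : ℝ} (hg0 : 0 ≤ g) (hgγ : g ≤ c.γ) :
    ContinuousOn (T.E k X z g)
      (T.space k X (enl n₀ βc (c.alpha0 (T.flow.g k))) (enl n₁ βc (c.alpha1 (T.flow.g k)))) :=
  (h.analyticE hk X z g hg0 hgγ).continuousOn

/-- … and of the newest `𝐑`-terms. [cite: Balaban1988Convergent, §2 p.262, (2.30) p.260] -/
theorem continuousOn_R (h : LFHypAnalyticImprovedSpace T c βc n₀ n₁ k SB) (hk : 1 ≤ k) (X : (T.sys k).Dom) :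
    ContinuousOn (T.R k X) (T.space k X (enl n₀ βc (c.alpha0 (T.flow.g k))) (enl n₁ βc (c.alpha1 (T.flow.g k)))) :=
  (h.analyticR hk X).continuousOn

/-- … and complex differentiability of the newest `𝐄`-terms on the slightly larger space (the form differentiated in the
Cauchy estimates of §3). [cite: Balaban1988Convergent, §2 p.262, §3 p.280] -/
theorem differentiableOn_E (h : LFHypAnalyticImprovedSpace T c βc n₀ n₁ k SB) (hk : 1 ≤ k) (X : (T.sys k).Dom)
    (z : T.Pt k) {g : ℝ} (hg0 : 0 ≤ g) (hgγ : g ≤ c.γ) :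
    DifferentiableOn ℂ (T.E k X z g)
      (T.space k X (enl n₀ βc (c.alpha0 (T.flow.g k))) (enl n₁ βc (c.alpha1 (T.flow.g k)))) :=
  (h.analyticE hk X z g hg0 hgγ).differentiableOn

variable {E : Type*} [NormedAddCommGroup E] [NormedSpace ℂ E]

/-- **The improved clause in a chart** — where print consumes «better analyticity»: for any holomorphic map `ch : E → Φ`
sending a set `s` INTO THE SLIGHTLY LARGER SPACE, the chart functional `B ↦ 𝐄^{(k)}(X, ch B, z)` is holomorphic on `s`; the
extra room `(1+n₀β)α_{0,k} − α_{0,k}` is what the Cauchy estimates on p. 280 (3.50) / p. 283 spend to produce the improved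
bounds *«needed for the R-operation»* (hypothesis `hf` of `B14Claim283RAnalytic`, `B14.Eq350KernelCauchy`).
[cite: Balaban1988Convergent, §2 p.262, (3.50) p.280, p.283] -/
theorem analyticOnNhd_E_chart (h : LFHypAnalyticImprovedSpace T c βc n₀ n₁ k SB) (hk : 1 ≤ k) (X : (T.sys k).Dom)
    (z : T.Pt k) {g : ℝ} (hg0 : 0 ≤ g) (hgγ : g ≤ c.γ) {ch : E → Φ} {s : Set E} (hch : AnalyticOnNhd ℂ ch s)
    (hmaps : MapsTo ch s (T.space k X (enl n₀ βc (c.alpha0 (T.flow.g k))) (enl n₁ βc (c.alpha1 (T.flow.g k))))) :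
    AnalyticOnNhd ℂ (fun B => T.E k X z g (ch B)) s :=
  (h.analyticE hk X z g hg0 hgγ).comp hch hmaps

/-- The same for the newest `𝐑`-terms. [cite: Balaban1988Convergent, §2 p.262, (2.30) p.260] -/
theorem analyticOnNhd_R_chart (h : LFHypAnalyticImprovedSpace T c βc n₀ n₁ k SB) (hk : 1 ≤ k) (X : (T.sys k).Dom)
    {ch : E → Φ} {s : Set E} (hch : AnalyticOnNhd ℂ ch s)
    (hmaps : MapsTo ch s (T.space k X (enl n₀ βc (c.alpha0 (T.flow.g k))) (enl n₁ βc (c.alpha1 (T.flow.g k))))) :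
    AnalyticOnNhd ℂ (fun B => T.R k X (ch B)) s :=
  (h.analyticR hk X).comp hch hmaps

/-- The same for the newest `𝐁`-terms on the enlarged boundary-term space `SB X`. [cite: Balaban1988Convergent, §2 p.262, (2.41)(ii) p.261] -/
theorem analyticOnNhd_B_chart (h : LFHypAnalyticImprovedSpace T c βc n₀ n₁ k SB) (hk : 1 ≤ k) (X : (T.sys k).Dom)
    (a : 𝔄) {ch : E → Φ} {s : Set E} (hch : AnalyticOnNhd ℂ ch s) (hmaps : MapsTo ch s (SB X)) :
    AnalyticOnNhd ℂ (fun B => T.B k X (ch B) a) s :=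
  (h.analyticB hk X a).comp hch hmaps

end LFHypAnalyticImprovedSpace

/-! ## §4  The whole p. 262 sentence: better analyticity AND decay on the slightly larger spaces -/

/-- **p. 262 as ONE predicate** on the newest terms at index `k`: *«defined on slightly larger spaces, with the coefficients in
their definition bigger by β multiplied by a corresponding number»* — BOTH what is defined there is analytic there
(`analytic`, this file) AND *«they have better decay properties, with the number κ replaced, for example, by (1+4β)κ»* on those
spaces (`decay`, the fold owner's `LFHypImprovedSpace`). [cite: Balaban1988Convergent, §2 p.262] -/
structure TImageImproved [NormedAddCommGroup Φ] [NormedSpace ℂ Φ] (T : LFTower P G Φ 𝒢 𝔄) (c : LFConsts)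
    (βc n₀ n₁ : ℝ) (k : ℕ) (SB : (T.sys k).Dom → Set Φ) : Prop where
  decay : LFHypImprovedSpace T c βc n₀ n₁ k SB
  analytic : LFHypAnalyticImprovedSpace T c βc n₀ n₁ k SB

namespace TImageImproved

variable [NormedAddCommGroup Φ] [NormedSpace ℂ Φ] {T : LFTower P G Φ 𝒢 𝔄} {c : LFConsts} {βc n₀ n₁ : ℝ} {k : ℕ}

/-- Vacuous at `k = 0` (no terms). [cite: Balaban1988Convergent, Thm 1 p.262] -/
protected theorem zero (T : LFTower P G Φ 𝒢 𝔄) (c : LFConsts) (βc n₀ n₁ : ℝ) (SB : (T.sys 0).Dom → Set Φ) :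
    TImageImproved T c βc n₀ n₁ 0 SB :=
  ⟨LFHypImprovedSpace.zero T c βc n₀ n₁ SB, LFHypAnalyticImprovedSpace.zero T c βc n₀ n₁ SB⟩

/-- The decay half restricts to the currency of `Step.LFNewTerms.improved` (`Step.LFHypImproved`, rate `(1+4β)κ` on the
ordinary spaces). [cite: Balaban1988Convergent, §2 p.262] -/
theorem toImproved {SB : (T.sys k).Dom → Set Φ} (h : TImageImproved T c βc n₀ n₁ k SB) : LFHypImproved T c βc k :=
  h.decay.toImproved

/-- The analyticity half restricts to the new-index clause on the ordinary spaces (inclusions from the decay half).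
[cite: Balaban1988Convergent, §2 p.262] -/
theorem toAnalyticAt {SB : (T.sys (k + 1)).Dom → Set Φ} (h : TImageImproved T c βc n₀ n₁ (k + 1) SB) :
    LFAnalyticAt T c k :=
  h.analytic.toAnalyticAt_of_improvedSpace h.decay

/-- With (ii) at the scales `≤ k`, the improved 𝐓-image data at `k+1` give (ii) at the scales `≤ k+1` — the analyticity
conjunct a law package at the next index asks for (e.g. `LFHypAnalytic T c (k+1)` in `Node00.Sect2.LawsT`).
[cite: Balaban1988Convergent, §2 p.262, §3 p.279] -/
theorem lfHypAnalytic_succ {SB : (T.sys (k + 1)).Dom → Set Φ} (hA : LFHypAnalytic T c k)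
    (h : TImageImproved T c βc n₀ n₁ (k + 1) SB) : LFHypAnalytic T c (k + 1) :=
  hA.succ h.toAnalyticAt

end TImageImproved

end Literature.MathematicalPhysics.QuantumFieldTheory.Balaban1983to89.B14.TkImagesAnalyticity

end
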